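import Summits.Langlands.Langlands.Theses.RepeatedRootSocle
import Literature.NumberTheory.GaloisRepresentations.CyclotomicCharacterFrobeniusProofs
import Literature.NumberTheory.GaloisRepresentations.SorensenPatching

/-!
# `PadicLimitUnrefined` (stmt-Langlands-18088): the hypotheses `Sympl ρ ∧ Pure ρ` are contradictory

Negative-side lemma (refuter crux-attack at birth `rattack-stmt-Langlands-18088`, 2026-08-17; supports
stmt-Langlands-18088; workfile `Cruxes/PadicLimitUnrefined/Disproof.lean`).

In the three typed items of route `RepeatedRootSocle` (`UnrefinedWeightTwoLifting`,
`LimitClassicalUnrefined`, `PadicLimitUnrefined`) the representation `ρ : Γ_ℚ →ₜ* GL₄(ℚ̄_p)` is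
assumed BOTH symplectic with multiplier `ε⁻¹` (inverse cyclotomic character — the cohomological
convention of Boxer–Calegari–Gee–Pilloni, `ρ = H¹`) AND pure of weight `+1` with an INTEGRAL
Frobenius characteristic polynomial `P ∈ ℤ[X]` at almost every place (the homological convention,
`ρ = V_p A`).  These cannot hold together:
taking determinants in `ρ(σ)ᵀ J ρ(σ) = ε(σ)⁻¹ • J` (`det J ≠ 0`, rank `4`) gives
`det ρ(σ)² = ε(σ)⁻⁴`; at an arithmetic Frobenius `σ` at a place `v ∤ p` one has `ε(σ) = N v = q`
(Serre, *Abelian ℓ-adic representations*, I-1.2; the tree's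
`GaloisRep.cyclotomicCharacter_apply_of_isArithFrobAt`) and `det ρ(σ) = P(0) ∈ ℤ`, whence
`P(0)² q⁴ = 1` in `ℤ` with `q ≥ 2` — impossible (`false_of_symplInvCyclo_of_integralFrobCharpoly`,
one place suffices; `false_of_sympl_of_pure`, the items' `∀ᶠ`-form).  Consequence recorded in the
workfile: all three items are vacuously TRUE as typed; the repair is multiplier `ε`.
No definition, no named fact; theorems only.
-/

noncomputable section


open scoped NumberField
open IsDedekindDomain Field Polynomial Filter
open Literature.NumberTheory.GaloisRepresentations

set_option linter.dupNamespace false -- `Summit.Langlands.Langlands` is the mandated namespace (D-0017)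

namespace Summit.Langlands.Langlands.Theorems.PadicLimitUnrefined.Negative

variable {p : ℕ} [Fact p.Prime]

/-- Core inconsistency: a rank-4 framed `p`-adic representation of `Γ_ℚ` that is symplectic with
multiplier `ε⁻¹` cannot have an integral Frobenius characteristic polynomial at a place `v ∤ p`
(`det² = q⁻⁴` versus `det = P(0) ∈ ℤ`). [folklore] -/
theorem false_of_symplInvCyclo_of_integralFrobCharpoly
    (ρ : FramedGaloisRep ℚ (PadicAlgCl p) 4)
    (hS : ρ.IsSymplecticWithMultiplierFun (fun g => algebraMap ℚ_[p] (PadicAlgCl p)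
      ((((GaloisRep.cyclotomicCharacter ℚ p g)⁻¹ : ℤ_[p]ˣ) : ℤ_[p]) : ℚ_[p])))
    {v : HeightOneSpectrum (𝓞 ℚ)} (hv : ((p : ℕ) : 𝓞 ℚ) ∉ v.asIdeal)
    {P : ℤ[X]} (hP : ρ.HasFrobCharpolyAt v (P.map (Int.castRingHom (PadicAlgCl p)))) :
    False := by
  obtain ⟨𝔓, h𝔓⟩ := v.primesAbove_nonempty
  obtain ⟨σ, hσ⟩ := HeightOneSpectrum.exists_isArithFrobAt_of_mem_primesAbove_holds h𝔓
  have hchar : ((ρ σ : GL (Fin 4) (PadicAlgCl p)) : Matrix (Fin 4) (Fin 4) (PadicAlgCl p)).charpoly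
      = P.map (Int.castRingHom (PadicAlgCl p)) := hP 𝔓 h𝔓 σ hσ
  obtain ⟨J, -, hJdet, hJ⟩ := hS
  have hσJ := hJ σ
  beta_reduce at hσJ
  set ν : PadicAlgCl p := algebraMap ℚ_[p] (PadicAlgCl p)
      ((((GaloisRep.cyclotomicCharacter ℚ p σ)⁻¹ : ℤ_[p]ˣ) : ℤ_[p]) : ℚ_[p]) with hν
  have hdet := congrArg Matrix.det hσJ
  rw [Matrix.det_mul, Matrix.det_mul, Matrix.det_transpose, Matrix.det_smul,
    Fintype.card_fin] at hdet
  have hJ0 : J.det ≠ 0 := hJdet.ne_zero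
  have key : ((ρ σ : GL (Fin 4) (PadicAlgCl p)) : Matrix (Fin 4) (Fin 4) (PadicAlgCl p)).det ^ 2
      = ν ^ 4 := by
    apply mul_right_cancel₀ hJ0
    linear_combination hdet
  -- the cyclotomic character at the arithmetic Frobenius `σ` is `q = N v`
  have hε : ((GaloisRep.cyclotomicCharacter ℚ p σ : ℤ_[p]ˣ) : ℤ_[p]) = (v.residueCard : ℤ_[p]) :=
    GaloisRep.cyclotomicCharacter_apply_of_isArithFrobAt hv h𝔓 hσ
  have hνq : ν * (v.residueCard : PadicAlgCl p) = 1 := by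
    have h1 : (((GaloisRep.cyclotomicCharacter ℚ p σ)⁻¹ : ℤ_[p]ˣ) : ℤ_[p]) *
        (v.residueCard : ℤ_[p]) = 1 := by
      rw [← hε, Units.inv_mul]
    have h2 := congrArg (fun x : ℤ_[p] => algebraMap ℚ_[p] (PadicAlgCl p) (x : ℚ_[p])) h1
    simpa [hν] using h2
  -- the determinant is the (integer) constant coefficient of the Frobenius polynomial
  have hdetP : ((ρ σ : GL (Fin 4) (PadicAlgCl p)) : Matrix (Fin 4) (Fin 4) (PadicAlgCl p)).det
      = ((P.coeff 0 : ℤ) : PadicAlgCl p) := by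
    rw [Matrix.det_eq_sign_charpoly_coeff, Fintype.card_fin, hchar, Polynomial.coeff_map,
      eq_intCast]
    norm_num
  have hC : ((P.coeff 0 : ℤ) : PadicAlgCl p) ^ 2 * (v.residueCard : PadicAlgCl p) ^ 4 = 1 := by
    rw [← hdetP, key, ← mul_pow, hνq, one_pow]
  have hZ : (P.coeff 0) ^ 2 * ((v.residueCard : ℕ) : ℤ) ^ 4 = 1 := by
    exact_mod_cast hC
  have hq : (2 : ℤ) ≤ ((v.residueCard : ℕ) : ℤ) := by exact_mod_cast v.one_lt_residueCard
  have hsq : (P.coeff 0) ^ 2 = 1 := Int.eq_one_of_mul_eq_one_right (sq_nonneg _) hZ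
  rw [hsq, one_mul] at hZ
  have h16 : (16 : ℤ) ≤ ((v.residueCard : ℕ) : ℤ) ^ 4 := by
    calc (16 : ℤ) = 2 ^ 4 := by norm_num
      _ ≤ ((v.residueCard : ℕ) : ℤ) ^ 4 := by gcongr
  omega

/-- The hypotheses `Sympl ρ ∧ Pure ρ` of the route items are contradictory: from the `∀ᶠ`-purity
extract one place `v ∤ p` with an integral Frobenius polynomial (there are infinitely many places,
`SorensenPatching.infinite_heightOneSpectrum`, and only finitely many contain `p`). [folklore] -/
theorem false_of_sympl_of_pure
    (ρ : FramedGaloisRep ℚ (PadicAlgCl p) 4)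
    (hS : ρ.IsSymplecticWithMultiplierFun (fun g => algebraMap ℚ_[p] (PadicAlgCl p)
      ((((GaloisRep.cyclotomicCharacter ℚ p g)⁻¹ : ℤ_[p]ˣ) : ℤ_[p]) : ℚ_[p])))
    (hPure : ∀ᶠ v : HeightOneSpectrum (𝓞 ℚ) in Filter.cofinite, ρ.IsUnramifiedAt v ∧
      ∃ P : Polynomial ℤ, ρ.HasFrobCharpolyAt v (P.map (Int.castRingHom (PadicAlgCl p))) ∧
        ∀ z : ℂ, (P.map (Int.castRingHom ℂ)).IsRoot z → ‖z‖ ^ 2 = (v.residueCard : ℝ)) :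
    False := by
  haveI := SorensenPatching.infinite_heightOneSpectrum ℚ
  -- only finitely many places contain `p`
  have hfin : ∀ᶠ v : HeightOneSpectrum (𝓞 ℚ) in Filter.cofinite, ((p : ℕ) : 𝓞 ℚ) ∉ v.asIdeal := by
    have hp0 : (Ideal.span {((p : ℕ) : 𝓞 ℚ)} : Ideal (𝓞 ℚ)) ≠ ⊥ := by
      rw [Ne, Ideal.span_singleton_eq_bot]
      exact_mod_cast (Fact.out : p.Prime).ne_zero
    refine (Ideal.finite_factors hp0).subset ?_
    intro v hv
    simp only [Set.mem_compl_iff, Set.mem_setOf_eq, not_not] at hv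
    simpa [Ideal.dvd_span_singleton] using hv
  obtain ⟨v, ⟨-, P, hP, -⟩, hv⟩ := (hPure.and hfin).exists
  exact false_of_symplInvCyclo_of_integralFrobCharpoly ρ hS hv hP

end Summit.Langlands.Langlands.Theorems.PadicLimitUnrefined.Negative
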